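import Summits.QuantumFields.BalabanUV.Beta.EriceRemainderEnclosureHistoryAutonomyComparisonMarkovCredit
import Summits.QuantumFields.BalabanUV.Beta.EriceRemainderEnclosureHistoryAutonomyComparisonDualContractionSharp

/-!
# EriceRemainderEnclosureHistoryAutonomyComparisonMarkovCreditSharp — (E139e) **THE MARKOV CREDIT LAW IS EXACT: for every age `L ≥ 1`, Markov slope `s > 0` and hinge
# slope `M̃` with `M̃·(1 − (1+s)^{−L}) > s` the PEDESTAL HINGE `B(w) = 1 + s·max(P − 1∕w_0², 0) + M̃·max(c − 1∕w_L², 0)` — an isotone memory with floor, zeroth moment,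
# one-age history profile `Λ_L = M̃` and Markov lower slope `s` below the pedestal cap `P`, which both orbits stay under throughout the comparison window — and its
# translate `B′ = B + s` (constant, hence isotone, excess) have box solutions from one pin with `h 1 < h′ 1` (`exists_violation_markov_credit`).**  (E139b)'s row
# condition for a one-age profile `Λ_L = M̃` against a Markov slope `s` reads `M̃·Σ_{j=1}^{L}(1+s)^{−j} = M̃(1 − (1+s)^{−L})∕s ≤ 1`: the credit bought by a Markov slope
# is exactly what (E139b) grants, no more.  (`s → 0`: (E56a) ∕ (E138d)'s `L·M̃ ≤ 1`.)

THE CONSTRUCTION (pin level `1`, floor `1`, excess `ε = s`, `r = (1+s)⁻¹`).  Under the cap the pedestal step from level `a` with source `e` is `a ↦ (a + 1 + e + sP)∕(1+s)`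
(`P − a_{m+1} = r·(P − a_m − 1 − e)`); written with a `max` against the uncapped step `a + 1 + e` it is the flow of the pedestal at EVERY level (`pstep_flow`), so the orbits
are forward recursions (`Nat.rec`) with no closed form needed below the window; the cap `P = 1 + (1+s)^{L+1}·(L+2)(2 + s + M̃)` keeps both orbits `≥ 2 + s + M̃` below it up
to row `L+1` (`window_lower`).  Perturbed orbit `a′`: pure pedestal with source `s`; activation level `c := a′_{L+1}` (hinge OFF along `a′`).  Base orbit `ã`: row `0` with the
hinge value `H = M̃(1 − r^{L+1})∕(1 + M̃r^{L+1})`, then pure pedestal; the lead `a′_m − ã_m = 1 − r^m(1 + H)` (`lead_eq`) gives the reading `c − ã_{L+1} = H∕M̃ ∈ [0,1]` at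
row `0` (the fixed point) and hinge OFF from row `1` on.  VIOLATION: `ã_1 > a′_1 ⟺ H > s ⟺ M̃(1 − r^L) > s`.  Numerics (g107 `kit/pedestal107.py`, Newton on the truncated
flow): failure at `M̃ ∕ threshold ∈ {1.05, 1.25, 2}` and comparison at `{0.8, 0.95}` in five `(b, s, L)` configurations.

Cell `pub-balaban`, β-function sub-cell, BINDER row D4 «RemainderConst leaves for Bałaban's split» (`HOME/BINDER-OWNERS.md`; owner lineage `b2b-balaban-beta-an4`;
this file by co-owner #2 lineage `b2b-balaban-beta-d4-p2`, generation 107), β-FLOW TEAM duty (1), FREEZE (0) honoured (def-free: functionals and level sequences are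
displayed lambda terms as in (E56a) ∕ (E138f); (E138f) `lhinge_mono` ∕ `lhinge_nonneg` ∕ `lhinge_le` ∕ `abs_lhinge_sub_le` ∕ `lhinge_sub_le_posPart` and node U2's
`one_div_sq_one_div_sqrt` BY NAME; nothing restated).  NOT CLAIMED: that (E139b) certifies the comparison side for THIS family literally — its ceiling `A + Kβ̄` reads the
Markov slope above the cap (`β̄ ≥ sP`); the two-ladder ceiling that does is the successor's item (g107 `README.md` §4).

HONEST FRAMING (page 1, verbatim and binding).  *"Discharging BetaPertH makes Bałaban's UV stability UNCONDITIONAL — a real constructive-QFT result; it is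
NOT the continuum limit and NOT the Clay problem."*  THIS FILE DISCHARGES NOTHING OF THE KIND.  Elementary real analysis about DISPLAYED abstract functionals on the box
]0,1]^ℕ — census examples, not facts; nothing about Bałaban's (1.22) limit functional is PRINTED in this form ([I] p. 298; GAPS G-t4-U2-1∕-2) or asserted.  Row D4 class
UNCHANGED (critical-path width 0; instance 0∕1; D4 DISCHARGE NO DATE).  NOT B12 Thm 2, NOT BetaPertH, NOT continuum YM, NOT Clay.

WHAT IS PROVED ([folklore]; 0 `def`, 0 sorry).  §1 `pstep_ge`, `pstep_active`, `pstep_flow`.  §2 `window_lower`, `lead_eq`.  §3 `hh_facts`, **`orbit_facts`**,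
`ph_at_levels`, `memFlow_of_levels`.  §4 `exists_window_orbits`, `flows_of_orbits`.  §5 **`exists_violation_markov_credit`**.
-/

noncomputable section
open Finset Set

namespace Summit.QuantumFields.BalabanUV.Beta.EriceRemainderEnclosureHistoryAutonomyComparisonMarkovCreditSharp

open Literature.MathematicalPhysics.QuantumFieldTheory.Balaban1983to89
open Literature.MathematicalPhysics.QuantumFieldTheory.Balaban1983to89.T4BetaStationary
open Literature.MathematicalPhysics.QuantumFieldTheory.Balaban1983to89.T4BetaFlowWellPosed
open Summit.QuantumFields.BalabanUV.Beta.EriceRemainderEnclosureHistoryAutonomyComparisonDualContractionSharp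
  (lhinge_mono lhinge_nonneg lhinge_le abs_lhinge_sub_le lhinge_sub_le_posPart)

/-! ## §1 The pedestal step -/

variable {s P e a : ℝ}

/-- The pedestal step `a ↦ max((a + 1 + e + sP)∕(1+s), a + 1 + e)` climbs at least the floor plus the source. [folklore] -/
theorem pstep_ge (s P e a : ℝ) : a + 1 + e ≤ max ((a + 1 + e + s * P) / (1 + s)) (a + 1 + e) := le_max_right _ _

/-- UNDER THE CAP the pedestal step is the contracting affine map: `a + 1 + e ≤ P ⟹ step = (a + 1 + e + sP)∕(1+s)`. [folklore] -/
theorem pstep_active (hs : 0 < s) (hcap : a + 1 + e ≤ P) :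
    max ((a + 1 + e + s * P) / (1 + s)) (a + 1 + e) = (a + 1 + e + s * P) / (1 + s) := by
  refine max_eq_left ?_
  rw [le_div_iff₀ (by linarith)]
  nlinarith

/-- **THE PEDESTAL STEP IS THE FLOW OF THE PEDESTAL AT EVERY LEVEL**: `x := max((a + 1 + e + sP)∕(1+s), a + 1 + e)` satisfies `x = a + (1 + s·max(P − x, 0)) + e` —
under the cap the first branch with `P − x ≥ 0`, above it the second with `P − x ≤ 0`. [folklore] -/
theorem pstep_flow (hs : 0 < s) :
    max ((a + 1 + e + s * P) / (1 + s)) (a + 1 + e) = a + (1 + s * max (P - max ((a + 1 + e + s * P) / (1 + s)) (a + 1 + e)) 0) + e := by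
  have h1s : 0 < 1 + s := by linarith
  rcases le_or_gt (a + 1 + e) P with hcap | hcap
  · rw [pstep_active hs hcap]
    have hPx : 0 ≤ P - (a + 1 + e + s * P) / (1 + s) := by
      rw [sub_nonneg, div_le_iff₀ h1s]; nlinarith
    rw [max_eq_left hPx]
    field_simp
    ring
  · have hbr : (a + 1 + e + s * P) / (1 + s) ≤ a + 1 + e := by
      rw [div_le_iff₀ h1s]; nlinarith
    rw [max_eq_right hbr, max_eq_right (by linarith)]
    ring

/-! ## §2 The window below the cap and the lead of the perturbed orbit -/

/-- **THE WINDOW STAYS BELOW THE CAP.**  A distance sequence `D` (cap minus level) with `D_0 = D₀` which, as long as `D_m ≥ ϑ` and `m ≤ L`, makes a step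
`D_{m+1} ≥ r·D_m − T` (`0 ≤ r ≤ 1`, `T ≥ 0`): if `r^{L+1}·D₀ − (L+1)·T ≥ ϑ` then `D_m ≥ ϑ` for every `m ≤ L+1` (indeed `D_m ≥ r^m D₀ − m·T`). [folklore] -/
theorem window_lower {D : ℕ → ℝ} {r T ϑ D₀ : ℝ} {L : ℕ} (hr0 : 0 ≤ r) (hr1 : r ≤ 1) (hT : 0 ≤ T) (hD0 : D 0 = D₀) (hD₀ : 0 ≤ D₀)
    (hstep : ∀ m, m ≤ L → ϑ ≤ D m → r * D m - T ≤ D (m + 1)) (hwin : ϑ ≤ r ^ (L + 1) * D₀ - ((L : ℝ) + 1) * T) :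
    ∀ m, m ≤ L + 1 → r ^ m * D₀ - (m : ℝ) * T ≤ D m ∧ ϑ ≤ D m := by
  -- the generic bound r^m D₀ − mT is at least the window bound for m ≤ L+1
  have hmono : ∀ m, m ≤ L + 1 → r ^ (L + 1) * D₀ - ((L : ℝ) + 1) * T ≤ r ^ m * D₀ - (m : ℝ) * T := by
    intro m hm
    have h1 : r ^ (L + 1) ≤ r ^ m := pow_le_pow_of_le_one hr0 hr1 hm
    have h2 : (m : ℝ) ≤ (L : ℝ) + 1 := by exact_mod_cast hm
    nlinarith [mul_le_mul_of_nonneg_right h1 hD₀]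
  intro m
  induction m with
  | zero => intro _; refine ⟨by simp [hD0], ?_⟩; have := hmono 0 (Nat.zero_le _); simp [hD0] at this ⊢; linarith
  | succ m ih =>
    intro hm
    have hmL : m ≤ L := by omega
    obtain ⟨ihb, ihθ⟩ := ih (by omega)
    have hst := hstep m hmL ihθ
    have hb : r ^ (m + 1) * D₀ - ((m : ℝ) + 1) * T ≤ D (m + 1) := by
      have h1 : r * (r ^ m * D₀ - (m : ℝ) * T) ≤ r * D m := mul_le_mul_of_nonneg_left ihb hr0
      have h2 : r * ((m : ℝ) * T) ≤ (m : ℝ) * T := mul_le_of_le_one_left (by positivity) hr1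
      rw [pow_succ]
      nlinarith
    refine ⟨by push_cast; exact hb, ?_⟩
    have := hmono (m + 1) hm
    push_cast at this
    linarith

/-- **THE LEAD OF THE PERTURBED ORBIT OVER THE HINGE BASE.**  Two level sequences under the cap: `a′_{m+1} = (a′_m + 1 + s + sP)∕(1+s)` for `m ≤ L` (pedestal with source
`s`) and `ã_{m+1} = (ã_m + 1 + sP)∕(1+s)` for `1 ≤ m ≤ L` with `a′_1 − ã_1 = 1 − r(1 + H)`, `r = (1+s)⁻¹`: then `a′_m − ã_m = 1 − r^m(1 + H)` for `1 ≤ m ≤ L+1` (the affine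
recursion `δ ↦ r(δ + s)` has the fixed point `1`). [folklore] -/
theorem lead_eq {a' ah : ℕ → ℝ} {s P H : ℝ} {L : ℕ} (hs : 0 < s)
    (ha' : ∀ m, 1 ≤ m → m ≤ L → a' (m + 1) = (a' m + 1 + s + s * P) / (1 + s))
    (hah : ∀ m, 1 ≤ m → m ≤ L → ah (m + 1) = (ah m + 1 + s * P) / (1 + s))
    (h1 : a' 1 - ah 1 = 1 - (1 + s)⁻¹ * (1 + H)) :
    ∀ m, 1 ≤ m → m ≤ L + 1 → a' m - ah m = 1 - ((1 + s)⁻¹) ^ m * (1 + H) := by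
  have h1s : (1 + s) ≠ 0 := by linarith
  intro m
  induction m with
  | zero => intro h _; exact absurd h (by norm_num)
  | succ m ih =>
    intro _ hm
    rcases Nat.eq_zero_or_pos m with hm0 | hm0
    · subst hm0; simpa using h1
    · have ihm := ih hm0 (by omega)
      rw [ha' m hm0 (by omega), hah m hm0 (by omega)]
      rw [show (a' m + 1 + s + s * P) / (1 + s) - (ah m + 1 + s * P) / (1 + s) = (1 + s)⁻¹ * ((a' m - ah m) + s) by
        field_simp; ring]
      rw [ihm, pow_succ]
      field_simp
      ring


/-! ## §3 The hinge value, the two orbits, the flow at explicit levels -/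

/-- THE HINGE VALUE `H = M̃(1 − ρ)∕(1 + M̃ρ)` (`ρ = (1+s)^{−(L+1)} ∈ ]0,1]`): `0 ≤ H ≤ M̃`, the FIXED-POINT identity `M̃·(1 − ρ(1 + H)) = H`, and `H > s` as soon as
`M̃(1 − ρ(1+s)) > s` (i.e. `M̃(1 − (1+s)^{−L}) > s`). [folklore] -/
theorem hh_facts {Mt ρ s : ℝ} (hMt : 0 < Mt) (hρ0 : 0 < ρ) (hρ1 : ρ ≤ 1) :
    0 ≤ Mt * (1 - ρ) / (1 + Mt * ρ) ∧ Mt * (1 - ρ) / (1 + Mt * ρ) ≤ Mt ∧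
      Mt * (1 - ρ * (1 + Mt * (1 - ρ) / (1 + Mt * ρ))) = Mt * (1 - ρ) / (1 + Mt * ρ) ∧
      (s < Mt * (1 - ρ * (1 + s)) → s < Mt * (1 - ρ) / (1 + Mt * ρ)) := by
  have hden : 0 < 1 + Mt * ρ := by positivity
  refine ⟨div_nonneg (mul_nonneg hMt.le (by linarith)) hden.le, ?_, by field_simp; ring, fun hlt => by rw [lt_div_iff₀ hden]; nlinarith⟩
  rw [div_le_iff₀ hden]; nlinarith [mul_pos hMt hρ0, mul_pos (mul_pos hMt hMt) hρ0]

/-- **THE TWO ORBITS IN THE WINDOW.**  Level sequences `a′` (pedestal step with source `s` from `1`) and `ã` (row `0` to `A1 = P − r(P − 2 − H)`, then pedestal steps without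
source), both at distance `≥ 1 + s` resp. `≥ 1` below the cap up to row `L+1`: they increase, stay `≥ 1`, and the LEAD `a′_m − ã_m = 1 − r^m(1 + H)` (`lead_eq`) makes the
hinge reading at row `0` equal to `H∕M̃ ∈ [0,1]` by the fixed-point identity. [folklore] -/
theorem orbit_facts {s P Hh A1 Mt : ℝ} {L : ℕ} {a' ah : ℕ → ℝ} (hs : 0 < s) (hMt : 0 < Mt) (hHh0 : 0 ≤ Hh)
    (ha'0 : a' 0 = 1) (ha'S : ∀ m, a' (m + 1) = max ((a' m + 1 + s + s * P) / (1 + s)) (a' m + 1 + s))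
    (hah0 : ah 0 = 1) (hah1 : ah 1 = A1) (hahS : ∀ m, 1 ≤ m → ah (m + 1) = max ((ah m + 1 + 0 + s * P) / (1 + s)) (ah m + 1 + 0))
    (hA1 : A1 = P - (1 + s)⁻¹ * (P - 2 - Hh)) (hA1ge : 1 ≤ A1)
    (hw' : ∀ m, m ≤ L + 1 → 1 + s ≤ P - a' m) (hwh : ∀ m, m ≤ L + 1 → 1 ≤ P - ah m)
    (hfix : Mt * (1 - ((1 + s)⁻¹) ^ (L + 1) * (1 + Hh)) = Hh) :
    Monotone a' ∧ Monotone ah ∧ (∀ m, 1 ≤ a' m) ∧ (∀ m, 1 ≤ ah m) ∧ (∀ m, 1 ≤ m → ah m + 1 ≤ ah (m + 1)) ∧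
      a' 1 - ah 1 = 1 - (1 + s)⁻¹ * (1 + Hh) ∧
      Mt * (a' (L + 1) - ah (L + 1)) = Hh ∧ 0 ≤ a' (L + 1) - ah (L + 1) ∧ a' (L + 1) - ah (L + 1) ≤ 1 := by
  have h1s : 0 < 1 + s := by linarith
  have hrs : (1 + s)⁻¹ * (1 + s) = 1 := inv_mul_cancel₀ h1s.ne'; have hr0 : 0 < (1 + s)⁻¹ := inv_pos.mpr h1s
  have ha'step : ∀ m, a' m + 1 + s ≤ a' (m + 1) := fun m => by rw [ha'S]; exact pstep_ge s P s (a' m)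
  have hahstep : ∀ m, 1 ≤ m → ah m + 1 ≤ ah (m + 1) := fun m hm => by
    rw [hahS m hm]; have h := pstep_ge s P 0 (ah m); simp only [add_zero] at h ⊢; exact h
  have ha'mono : Monotone a' := monotone_nat_of_le_succ fun m => by linarith [ha'step m]
  have hahmono : Monotone ah := monotone_nat_of_le_succ fun m => by
    rcases Nat.eq_zero_or_pos m with h0 | hpos
    · subst h0; rw [show ah (0 + 1) = ah 1 from rfl, hah1, hah0]; exact hA1ge
    · linarith [hahstep m hpos]
  have ha'1 : ∀ m, 1 ≤ a' m := fun m => by rw [← ha'0]; exact ha'mono (Nat.zero_le m)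
  have hah1le : ∀ m, 1 ≤ ah m := fun m => by rw [← hah0]; exact hahmono (Nat.zero_le m)
  have ha'act : ∀ m, 1 ≤ m → m ≤ L → a' (m + 1) = (a' m + 1 + s + s * P) / (1 + s) := fun m _ hm => by
    rw [ha'S]; exact pstep_active hs (by linarith [hw' m (by omega)])
  have hahact : ∀ m, 1 ≤ m → m ≤ L → ah (m + 1) = (ah m + 1 + s * P) / (1 + s) := fun m hm1 hm => by
    rw [hahS m hm1, pstep_active hs (by linarith [hwh m (by omega)])]; ring
  have hlead1 : a' 1 - ah 1 = 1 - (1 + s)⁻¹ * (1 + Hh) := by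
    have e1 : a' 1 = (a' 0 + 1 + s + s * P) / (1 + s) := by
      rw [show a' 1 = a' (0 + 1) from rfl, ha'S]; exact pstep_active hs (by linarith [hw' 0 (by omega)])
    rw [e1, hah1, hA1, ha'0, div_eq_inv_mul]
    linear_combination (2 + P - 1) * hrs
  have hlead := lead_eq (a' := a') (ah := ah) (L := L) hs ha'act hahact hlead1 (L + 1) (by omega) le_rfl
  have hread : Mt * (a' (L + 1) - ah (L + 1)) = Hh := by rw [hlead]; exact hfix
  have hread0 : 0 ≤ a' (L + 1) - ah (L + 1) := (mul_nonneg_iff_of_pos_left hMt).mp (by rw [hread]; exact hHh0)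
  have hread1 : a' (L + 1) - ah (L + 1) ≤ 1 := by rw [hlead]; nlinarith [pow_pos hr0 (L + 1)]
  exact ⟨ha'mono, hahmono, ha'1, hah1le, hahstep, hlead1, hread, hread0, hread1⟩

/-- THE PEDESTAL HINGE READ AT EXPLICIT LEVELS: on the history `(1∕√a_{n+1+i})_i` of a level sequence `a ≥ 1` it takes the value
`1 + s·max(P − a_{n+1}, 0) + M̃·max(c − a_{n+1+L}, 0)`. [folklore] -/
theorem ph_at_levels {s P c Mt : ℝ} {L : ℕ} {a : ℕ → ℝ} (ha1 : ∀ m, 1 ≤ a m) (n : ℕ) :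
    (fun w : ℕ → ℝ => 1 + s * max (P - 1 / w 0 ^ 2) 0 + Mt * max (c - 1 / w L ^ 2) 0) (fun i => 1 / Real.sqrt (a (n + 1 + i)))
      = 1 + s * max (P - a (n + 1)) 0 + Mt * max (c - a (n + 1 + L)) 0 := by
  simp only [add_zero]
  rw [one_div_sq_one_div_sqrt (by linarith [ha1 (n + 1)]), one_div_sq_one_div_sqrt (by linarith [ha1 (n + 1 + L)])]

/-- A level sequence `a ≥ 1` with `a_{n+1} = a_n + B(history at scale n+1) + e` is, read as couplings `1∕√a`, a box-]0,1] solution of `B + e` from the pin `1∕√a_0`. [folklore] -/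
theorem memFlow_of_levels {B : (ℕ → ℝ) → ℝ} {a : ℕ → ℝ} {e : ℝ} (ha1 : ∀ m, 1 ≤ a m)
    (hrec : ∀ n, a (n + 1) = a n + (B (fun i => 1 / Real.sqrt (a (n + 1 + i))) + e)) :
    SeqBox 1 (fun j => 1 / Real.sqrt (a j)) ∧ MemFlow (fun w => B w + e) (1 / Real.sqrt (a 0)) (fun j => 1 / Real.sqrt (a j)) := by
  refine ⟨fun j => ?_, rfl, fun n => ?_⟩
  · have hpos : 0 < Real.sqrt (a j) := Real.sqrt_pos.mpr (by linarith [ha1 j])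
    refine ⟨by positivity, ?_⟩
    rw [div_le_one hpos]
    calc (1 : ℝ) = Real.sqrt 1 := Real.sqrt_one.symm
      _ ≤ Real.sqrt (a j) := Real.sqrt_le_sqrt (ha1 j)
  · simp only
    rw [one_div_sq_one_div_sqrt (by linarith [ha1 (n + 1)]), one_div_sq_one_div_sqrt (by linarith [ha1 n])]
    exact hrec n

/-! ## §4 The cap, the orbits, their flows -/

/-- **THE CAP AND THE TWO ORBITS.**  For `M̃(1 − (1+s)^{−L}) > s`: a cap `P > 0`, the hinge value `H ≥ 0` with `H > s` and the fixed-point identity, and the two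
level sequences of §3 (forward recursions of the pedestal step) staying `≥ 2 + s + M̃` below the cap up to row `L+1` (`window_lower` with
`P = 1 + (1+s)^{L+1}((L+2)(2+s+M̃))`). [folklore] -/
theorem exists_window_orbits {L : ℕ} {s Mt : ℝ} (hs : 0 < s) (hMt : 0 < Mt) (hviol : s < Mt * (1 - ((1 + s)⁻¹) ^ L)) :
    ∃ (P Hh A1 : ℝ) (a' ah : ℕ → ℝ), 0 < P ∧ 0 ≤ Hh ∧ s < Hh ∧ Mt * (1 - ((1 + s)⁻¹) ^ (L + 1) * (1 + Hh)) = Hh ∧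
      a' 0 = 1 ∧ (∀ m, a' (m + 1) = max ((a' m + 1 + s + s * P) / (1 + s)) (a' m + 1 + s)) ∧
      ah 0 = 1 ∧ ah 1 = A1 ∧ (∀ m, 1 ≤ m → ah (m + 1) = max ((ah m + 1 + 0 + s * P) / (1 + s)) (ah m + 1 + 0)) ∧
      A1 = P - (1 + s)⁻¹ * (P - 2 - Hh) ∧ 1 ≤ A1 ∧
      (∀ m, m ≤ L + 1 → 2 + s + Mt ≤ P - a' m) ∧ (∀ m, m ≤ L + 1 → 2 + s + Mt ≤ P - ah m) := by
  have h1s : 0 < 1 + s := by linarith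
  have hr0 : 0 < (1 + s)⁻¹ := inv_pos.mpr h1s
  have hr1 : (1 + s)⁻¹ < 1 := inv_lt_one_of_one_lt₀ (by linarith)
  have hrs : (1 + s)⁻¹ * (1 + s) = 1 := inv_mul_cancel₀ h1s.ne'
  have hρL : ((1 + s)⁻¹) ^ (L + 1) * (1 + s) = ((1 + s)⁻¹) ^ L := by rw [pow_succ, mul_assoc, hrs, mul_one]
  obtain ⟨hHh0, hHhMt, hfix, hsHh⟩ := hh_facts (s := s) hMt (pow_pos hr0 (L + 1)) (pow_le_one₀ hr0.le hr1.le)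
  have hsHh := hsHh (by rw [hρL]; exact hviol)
  obtain ⟨Hh, hHhdef⟩ : ∃ Hh : ℝ, Hh = Mt * (1 - ((1 + s)⁻¹) ^ (L + 1)) / (1 + Mt * ((1 + s)⁻¹) ^ (L + 1)) := ⟨_, rfl⟩
  rw [← hHhdef] at hHh0 hHhMt hsHh
  have hfix' : Mt * (1 - ((1 + s)⁻¹) ^ (L + 1) * (1 + Hh)) = Hh := by rw [hHhdef]; exact hfix
  -- the cap: distance D₀ of the pin below it, with r^{L+1}·D₀ = (L+1)T + T, T = 2+s+M̃
  have hT0 : 0 ≤ 2 + s + Mt := by positivity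
  obtain ⟨D₀, hD₀0, hrD₀, hD₀ge⟩ : ∃ D₀ : ℝ, 0 ≤ D₀ ∧ ((1 + s)⁻¹) ^ (L + 1) * D₀ = ((L : ℝ) + 1) * (2 + s + Mt) + (2 + s + Mt)
      ∧ 2 + s + Mt ≤ D₀ := by
    have hQ0 : 0 ≤ ((L : ℝ) + 1) * (2 + s + Mt) := by positivity
    have hpow1 : 1 ≤ (1 + s) ^ (L + 1) := one_le_pow₀ (by linarith)
    refine ⟨(1 + s) ^ (L + 1) * (((L : ℝ) + 1) * (2 + s + Mt) + (2 + s + Mt)), by positivity, ?_, by nlinarith⟩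
    rw [← mul_assoc, ← mul_pow, hrs, one_pow, one_mul]
  obtain ⟨P, hP⟩ : ∃ P : ℝ, P = 1 + D₀ := ⟨_, rfl⟩
  have hP0 : 0 < P := by rw [hP]; linarith
  obtain ⟨a', ha'0, ha'S⟩ : ∃ a' : ℕ → ℝ, a' 0 = 1 ∧ ∀ m, a' (m + 1) = max ((a' m + 1 + s + s * P) / (1 + s)) (a' m + 1 + s) :=
    ⟨fun m => Nat.rec (motive := fun _ => ℝ) 1 (fun _ x => max ((x + 1 + s + s * P) / (1 + s)) (x + 1 + s)) m, rfl, fun m => rfl⟩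
  obtain ⟨A1, hA1⟩ : ∃ A1 : ℝ, A1 = P - (1 + s)⁻¹ * (P - 2 - Hh) := ⟨_, rfl⟩
  obtain ⟨ah, hah0, hah1, hahS⟩ : ∃ ah : ℕ → ℝ, ah 0 = 1 ∧ ah 1 = A1 ∧
      ∀ m, 1 ≤ m → ah (m + 1) = max ((ah m + 1 + 0 + s * P) / (1 + s)) (ah m + 1 + 0) := by
    refine ⟨fun m => Nat.rec (motive := fun _ => ℝ) 1
        (fun n x => Nat.rec (motive := fun _ => ℝ) A1 (fun _ _ => max ((x + 1 + 0 + s * P) / (1 + s)) (x + 1 + 0)) n) m,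
      rfl, rfl, fun m hm => ?_⟩
    cases m with
    | zero => exact absurd hm (by norm_num)
    | succ k => rfl
  have hA1ge : 1 ≤ A1 := by
    have : (1 + s)⁻¹ * (P - 2 - Hh) ≤ P - 2 - Hh := mul_le_of_le_one_left (by rw [hP]; linarith) hr1.le
    rw [hA1]; linarith
  have hwin' := window_lower (D := fun m => P - a' m) (ϑ := 2 + s + Mt) (T := 2 + s + Mt) (L := L) hr0.le hr1.le hT0
    (show P - a' 0 = D₀ by rw [ha'0, hP]; ring) hD₀0
    (fun m _ hθ => by
      have hθ' : 2 + s + Mt ≤ P - a' m := hθ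
      show (1 + s)⁻¹ * (P - a' m) - (2 + s + Mt) ≤ P - a' (m + 1)
      rw [ha'S, pstep_active hs (by linarith), div_eq_inv_mul]
      nlinarith [hrs])
    (by rw [hrD₀]; linarith)
  have hwinh := window_lower (D := fun m => P - ah m) (ϑ := 2 + s + Mt) (T := 2 + s + Mt) (L := L) hr0.le hr1.le hT0
    (show P - ah 0 = D₀ by rw [hah0, hP]; ring) hD₀0
    (fun m _ hθ => by
      have hθ' : 2 + s + Mt ≤ P - ah m := hθ
      show (1 + s)⁻¹ * (P - ah m) - (2 + s + Mt) ≤ P - ah (m + 1)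
      rcases Nat.eq_zero_or_pos m with h0 | hpos
      · subst h0
        rw [show ah (0 + 1) = ah 1 from rfl, hah1, hA1, hah0]
        have : (1 + s)⁻¹ * (1 + Hh) ≤ 1 + Hh := mul_le_of_le_one_left (by linarith) hr1.le
        nlinarith
      · rw [hahS m hpos, pstep_active hs (by linarith), div_eq_inv_mul]
        nlinarith [hrs])
    (by rw [hrD₀]; linarith)
  exact ⟨P, Hh, A1, a', ah, hP0, hHh0, hsHh, hfix', ha'0, ha'S, hah0, hah1, hahS, hA1, hA1ge,
    fun m hm => (hwin' m hm).2, fun m hm => (hwinh m hm).2⟩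

/-- **THE TWO HISTORIES SOLVE THE TWO FLOWS.**  With `c = a′_{L+1}`: the hinge is OFF along `a′` (levels increase) and along `ã` from row `1` on (`ã_{L+2} ≥ ã_{L+1} + 1 ≥ c`),
and reads `H∕M̃` at row `0` of `ã`; so `1∕√a′` solves `B + s` and `1∕√ã` solves `B` from the pin `1` (`pstep_flow`, `memFlow_of_levels`). [folklore] -/
theorem flows_of_orbits {L : ℕ} {s P Hh A1 Mt : ℝ} {a' ah : ℕ → ℝ} (hs : 0 < s)
    (ha'0 : a' 0 = 1) (ha'S : ∀ m, a' (m + 1) = max ((a' m + 1 + s + s * P) / (1 + s)) (a' m + 1 + s))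
    (hah0 : ah 0 = 1) (hah1 : ah 1 = A1) (hahS : ∀ m, 1 ≤ m → ah (m + 1) = max ((ah m + 1 + 0 + s * P) / (1 + s)) (ah m + 1 + 0))
    (hA1 : A1 = P - (1 + s)⁻¹ * (P - 2 - Hh)) (hPA : 0 ≤ P - A1)
    (ha'mono : Monotone a') (hahmono : Monotone ah) (ha'1 : ∀ m, 1 ≤ a' m) (hah1le : ∀ m, 1 ≤ ah m)
    (hahstep : ∀ m, 1 ≤ m → ah m + 1 ≤ ah (m + 1))
    (hread : Mt * (a' (L + 1) - ah (L + 1)) = Hh) (hread0 : 0 ≤ a' (L + 1) - ah (L + 1)) (hread1 : a' (L + 1) - ah (L + 1) ≤ 1) :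
    SeqBox 1 (fun j => 1 / Real.sqrt (ah j)) ∧
      MemFlow (fun w : ℕ → ℝ => 1 + s * max (P - 1 / w 0 ^ 2) 0 + Mt * max (a' (L + 1) - 1 / w L ^ 2) 0) 1 (fun j => 1 / Real.sqrt (ah j)) ∧
      SeqBox 1 (fun j => 1 / Real.sqrt (a' j)) ∧
      MemFlow (fun w : ℕ → ℝ => (1 + s * max (P - 1 / w 0 ^ 2) 0 + Mt * max (a' (L + 1) - 1 / w L ^ 2) 0) + s) 1 (fun j => 1 / Real.sqrt (a' j)) := by
  have h1s : 0 < 1 + s := by linarith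
  have hrs : (1 + s)⁻¹ * (1 + s) = 1 := inv_mul_cancel₀ h1s.ne'
  have hoff' : ∀ n, max (a' (L + 1) - a' (n + 1 + L)) 0 = 0 := fun n =>
    max_eq_right (by linarith [ha'mono (show L + 1 ≤ n + 1 + L by omega)])
  have hoffh : ∀ n, 1 ≤ n → max (a' (L + 1) - ah (n + 1 + L)) 0 = 0 := fun n hn =>
    max_eq_right (by
      have h1 := hahstep (L + 1) (by omega)
      have h2 := hahmono (show L + 1 + 1 ≤ n + 1 + L by omega)
      linarith)
  have hrec' : ∀ n, a' (n + 1) = a' n + ((fun w : ℕ → ℝ => 1 + s * max (P - 1 / w 0 ^ 2) 0 + Mt * max (a' (L + 1) - 1 / w L ^ 2) 0)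
      (fun i => 1 / Real.sqrt (a' (n + 1 + i))) + s) := fun n => by
    rw [ph_at_levels ha'1 n, hoff' n, mul_zero, add_zero, ha'S n]
    have := pstep_flow (P := P) (e := s) (a := a' n) hs
    linarith
  have hrech : ∀ n, ah (n + 1) = ah n + ((fun w : ℕ → ℝ => 1 + s * max (P - 1 / w 0 ^ 2) 0 + Mt * max (a' (L + 1) - 1 / w L ^ 2) 0)
      (fun i => 1 / Real.sqrt (ah (n + 1 + i))) + 0) := fun n => by
    rw [ph_at_levels hah1le n, add_zero]
    rcases Nat.eq_zero_or_pos n with h0 | hpos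
    · subst h0
      rw [show (0 : ℕ) + 1 + L = L + 1 by omega, max_eq_left hread0, hread, show ah (0 + 1) = ah 1 from rfl, hah1, hah0,
        max_eq_left hPA, hA1]
      linear_combination (-(P - 2 - Hh)) * hrs
    · rw [hoffh n hpos, mul_zero, add_zero, hahS n hpos]
      have := pstep_flow (P := P) (e := 0) (a := ah n) hs
      linarith
  obtain ⟨hbox', hflow'⟩ := memFlow_of_levels
    (B := fun w : ℕ → ℝ => 1 + s * max (P - 1 / w 0 ^ 2) 0 + Mt * max (a' (L + 1) - 1 / w L ^ 2) 0) (e := s) ha'1 hrec'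
  obtain ⟨hboxh, hflowh⟩ := memFlow_of_levels
    (B := fun w : ℕ → ℝ => 1 + s * max (P - 1 / w 0 ^ 2) 0 + Mt * max (a' (L + 1) - 1 / w L ^ 2) 0) (e := 0) hah1le hrech
  rw [ha'0, Real.sqrt_one, div_one] at hflow'
  rw [hah0, Real.sqrt_one, div_one] at hflowh
  simp only [add_zero] at hflowh
  exact ⟨hboxh, hflowh, hbox', hflow'⟩

/-! ## §5 The Markov credit law is exact -/

/-- **THE MARKOV CREDIT LAW IS EXACT.**  For every age `L ≥ 1`, Markov slope `s > 0` and hinge slope `M̃ > 0` with **`M̃·(1 − (1+s)^{−L}) > s`**: on the box `]0,1]^ℕ`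
a cap `P`, an activation level `c`, the PEDESTAL HINGE `B(w) = 1 + s·max(P − 1∕w_0², 0) + M̃·max(c − 1∕w_L², 0)` (displayed: ISOTONE, floor `1`, a zeroth moment,
bounded), its translate `B′ = B + s` (constant, hence isotone, excess) and box solutions `h`, `h′` from the pin `1` which stay BELOW THE CAP through the window
(`1∕h_m² + 1 ≤ P`, `1∕h′_m² + 1 + s ≤ P`, `m ≤ L+1`: there the pedestal is the affine Markov term of slope `s`) with **`h 1 < h′ 1`** — comparison FAILS.  The history
profile of `B` is the single age `L` with slope `M̃`, so (E139b)'s row quantity is `M̃·Σ_{j=1}^{L}(1+s)^{−j} = M̃(1 − (1+s)^{−L})∕s`: beyond `1` the Markov credit cannot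
be improved (`s → 0`: (E56a) ∕ (E138d)). [folklore] -/
theorem exists_violation_markov_credit {L : ℕ} (hL : 1 ≤ L) {s Mt : ℝ} (hs : 0 < s) (hMt : 0 < Mt)
    (hviol : s < Mt * (1 - ((1 + s)⁻¹) ^ L)) :
    ∃ (γ b M βb P c : ℝ) (B B' : (ℕ → ℝ) → ℝ) (p : ℝ) (h h' : ℕ → ℝ),
      (∀ w, B w = b + s * max (P - 1 / w 0 ^ 2) 0 + Mt * max (c - 1 / w L ^ 2) 0) ∧ (∀ w, B' w = B w + s) ∧
      (∀ u v : ℕ → ℝ, SeqBox γ u → SeqBox γ v → (∀ i, u i ≤ v i) → B u ≤ B v) ∧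
      (∀ u u' : ℕ → ℝ, SeqBox γ u → SeqBox γ u' → ∀ D : ℝ, (∀ j, |u j - u' j| ≤ D) → |B u - B u'| ≤ M * D) ∧ 0 ≤ M ∧
      0 < b ∧ (∀ u, SeqBox γ u → b ≤ B u) ∧ (∀ u, SeqBox γ u → B u ≤ B' u) ∧ (∀ u, SeqBox γ u → B' u ≤ βb) ∧
      (∀ u v : ℕ → ℝ, SeqBox γ u → SeqBox γ v → (∀ i, u i ≤ v i) → B' u - B u ≤ B' v - B v) ∧
      0 < p ∧ p ≤ γ ∧ SeqBox γ h ∧ MemFlow B p h ∧ SeqBox γ h' ∧ MemFlow B' p h' ∧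
      (∀ m, m ≤ L + 1 → 1 / h m ^ 2 + 1 ≤ P ∧ 1 / h' m ^ 2 + 1 + s ≤ P) ∧
      h 1 < h' 1 := by
  have h1s : 0 < 1 + s := by linarith
  obtain ⟨P, Hh, A1, a', ah, hP0, hHh0, hsHh, hfix, ha'0, ha'S, hah0, hah1, hahS, hA1, hA1ge, hw', hwh⟩ :=
    exists_window_orbits (L := L) hs hMt hviol
  obtain ⟨ha'mono, hahmono, ha'1, hah1le, hahstep, hlead1, hread, hread0, hread1⟩ :=
    orbit_facts (L := L) hs hMt hHh0 ha'0 ha'S hah0 hah1 hahS hA1 hA1ge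
      (fun m hm => by linarith [hw' m hm]) (fun m hm => by linarith [hwh m hm]) hfix
  have hPA : 0 ≤ P - A1 := by have := hwh 1 (by omega); rw [hah1] at this; linarith
  obtain ⟨hboxh, hflowh, hbox', hflow'⟩ :=
    flows_of_orbits (L := L) (Mt := Mt) hs ha'0 ha'S hah0 hah1 hahS hA1 hPA ha'mono hahmono ha'1 hah1le hahstep hread hread0 hread1
  have hc0 : 0 < a' (L + 1) := by linarith [ha'1 (L + 1)]
  have hconst : ∀ u : ℕ → ℝ, (1 + s * max (P - 1 / u 0 ^ 2) 0 + Mt * max (a' (L + 1) - 1 / u L ^ 2) 0) + s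
      - (1 + s * max (P - 1 / u 0 ^ 2) 0 + Mt * max (a' (L + 1) - 1 / u L ^ 2) 0) = s := fun u => by ring
  refine ⟨1, 1, s * (2 * P * Real.sqrt P) + Mt * (2 * a' (L + 1) * Real.sqrt (a' (L + 1))), 1 + s * P + Mt * a' (L + 1) + s, P, a' (L + 1),
    fun w => 1 + s * max (P - 1 / w 0 ^ 2) 0 + Mt * max (a' (L + 1) - 1 / w L ^ 2) 0,
    fun w => (1 + s * max (P - 1 / w 0 ^ 2) 0 + Mt * max (a' (L + 1) - 1 / w L ^ 2) 0) + s,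
    1, fun j => 1 / Real.sqrt (ah j), fun j => 1 / Real.sqrt (a' j),
    fun w => rfl, fun w => rfl, ?_, ?_, by positivity, one_pos, ?_, fun u _ => le_add_of_nonneg_right hs.le, ?_,
    fun u v _ _ _ => by rw [hconst u, hconst v], one_pos, le_rfl, hboxh, hflowh, hbox', hflow', ?_, ?_⟩
  · -- isotone
    intro u v hu _ huv
    have h0 := lhinge_mono (c := P) (hu 0).1 (huv 0)
    have hLm := lhinge_mono (c := a' (L + 1)) (hu L).1 (huv L)
    nlinarith [mul_le_mul_of_nonneg_left h0 hs.le, mul_le_mul_of_nonneg_left hLm hMt.le]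
  · -- zeroth moment
    intro u u' hu hu' D hD
    rw [show 1 + s * max (P - 1 / u 0 ^ 2) 0 + Mt * max (a' (L + 1) - 1 / u L ^ 2) 0
        - (1 + s * max (P - 1 / u' 0 ^ 2) 0 + Mt * max (a' (L + 1) - 1 / u' L ^ 2) 0)
        = s * (max (P - 1 / u 0 ^ 2) 0 - max (P - 1 / u' 0 ^ 2) 0)
          + Mt * (max (a' (L + 1) - 1 / u L ^ 2) 0 - max (a' (L + 1) - 1 / u' L ^ 2) 0) by ring]
    refine (abs_add_le _ _).trans ?_
    rw [abs_mul, abs_mul, abs_of_pos hs, abs_of_pos hMt]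
    have hA' := (abs_lhinge_sub_le (c := P) hP0 (hu 0).1 (hu' 0).1).trans
      (mul_le_mul_of_nonneg_left (hD 0) (by positivity : (0 : ℝ) ≤ 2 * P * Real.sqrt P))
    have hB' := (abs_lhinge_sub_le (c := a' (L + 1)) hc0 (hu L).1 (hu' L).1).trans
      (mul_le_mul_of_nonneg_left (hD L) (by positivity : (0 : ℝ) ≤ 2 * a' (L + 1) * Real.sqrt (a' (L + 1))))
    nlinarith [mul_le_mul_of_nonneg_left hA' hs.le, mul_le_mul_of_nonneg_left hB' hMt.le]
  · -- floor
    intro u _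
    nlinarith [mul_nonneg hs.le (lhinge_nonneg P (u 0)), mul_nonneg hMt.le (lhinge_nonneg (a' (L + 1)) (u L))]
  · -- bounded
    intro u _
    nlinarith [mul_le_mul_of_nonneg_left (lhinge_le hP0.le (u 0)) hs.le, mul_le_mul_of_nonneg_left (lhinge_le hc0.le (u L)) hMt.le]
  · -- the window is below the cap
    intro m hm
    rw [one_div_sq_one_div_sqrt (by linarith [hah1le m]), one_div_sq_one_div_sqrt (by linarith [ha'1 m])]
    exact ⟨by linarith [hwh m hm], by linarith [hw' m hm]⟩
  · -- the violation at scale 1: a′ 1 < ã 1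
    have hlt : a' 1 < ah 1 := by
      have : 1 < (1 + s)⁻¹ * (1 + Hh) := by rw [← div_eq_inv_mul, one_lt_div h1s]; linarith
      linarith
    have hpos' : 0 < a' 1 := by linarith [ha'1 1]
    exact one_div_lt_one_div_of_lt (Real.sqrt_pos.mpr hpos') (Real.sqrt_lt_sqrt hpos'.le hlt)

end Summit.QuantumFields.BalabanUV.Beta.EriceRemainderEnclosureHistoryAutonomyComparisonMarkovCreditSharp

end
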